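import Mathlib.Combinatorics.SimpleGraph.Ends.Properties
import Summits.CriticalPhenomena.PercolationContinuityZ3.Theorems.Transplant.CayleyMilnorKernel
import HarnessLib

/-!
# ONE END from a COMMUTING PAIR: two elementwise-commuting, trivially-intersecting, INFINITE finitely generated subgroups whose product is
# co-bounded force `Cay(Γ; S)` to have EXACTLY ONE END (Mathlib `SimpleGraph.end`) — for EVERY group `Γ` and EVERY finite generating set `S`

builds on p205010 (kernel theorem, internal audit signed; external expert review pending) — nothing in this file uses p205010; pure graph / group
theory, no percolation statement, no node touched.  Lane `prim-bschramm`, seat `prim-bschramm-gen-1` gen 10 (GEN pen; offer O-OE file F-OE1, lead g27 GO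
2026-08-28T16:29Z #8552, refuter math note p5-g32 #8551).  Helper file (`--supports stmt-CriticalPhenomena-4575 --as helper`).  Def-free (proof lane); no
instance, no notation.  Customer: «GrigorchukOneEnd» (F-OE2: the two certified witnesses `Cay(𝔊; a,b,c,d)`, `Cay(𝔊 × ℤ; a,b,c,d,z)` of the residue node).

CONTENT.
* §1 **ONE-END CRITERION** (graph level, Mathlib's ends = sections of `K ↦ components of G ∖ K`): a locally finite, preconnected, infinite graph such
  that for every finite `K` there is a finite `L` off which any two vertices are joined by a walk avoiding `K` has EXACTLY ONE END
  (`end_existsUnique_of_farConnected`; existence = Mathlib `nonempty_ends_of_infinite`, uniqueness: the component an end selects off `K` is infinite —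
  `end_componentCompl_infinite` — so it meets the complement of `L`).  [typed by gen-1 g9 as a draft, filed here]
* §2 **THE COMMUTING-PAIR THEOREM** `end_existsUnique_of_commuting_subgroups`: `Γ = ⟨S⟩` (any finite `S`), `H₁, H₂ ≤ Γ` finitely generated and
  INFINITE with `ab = ba` (`a ∈ H₁`, `b ∈ H₂`), `H₁ ⊓ H₂ = 1`, and `H₁·H₂` CO-BOUNDED on the right (`∃` finite `F`, every `g` has `g f ∈ H₁ H₂` for some
  `f ∈ F` — e.g. `H₁ H₂ ⊇` a finite-index subgroup) ⟹ `∃! e, e ∈ (mulCayley ↑S).end`.  PROOF (elementary; no word metric, no undistortion, no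
  Schreier graph): fix `S`-walks `1 → t` for the finitely many letters `t` of `T₁^{±} ∪ T₂^{±} ∪ F` (`Tᵢ` generating `Hᵢ`), `P` = all their vertices.
  Given a finite `K`, call `a ∈ H₁` DEEP if `a b q ∉ K` for all `b ∈ H₂`, `q ∈ P` (same for `H₂`).  Since `(a, b) ↦ ab` is injective on `H₁ × H₂`,
  a non-deep `a` is the FIRST FACTOR of an element of the finite set `K P⁻¹`: finitely many — so deep `a∞ ∈ H₁`, `b∞ ∈ H₂` exist (both groups are
  infinite), and the products (non-deep)·(non-deep) form a finite set `SM`.  Off `L = (K ∪ SM) P⁻¹` every vertex `u` walks to `u f = a b` along the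
  translate of the fixed walk for `f` (vertices `u q ∉ K`), with `a` deep or `b` deep; if `b` is deep the translates of the `T₁`-letter walks move
  `a' b ↦ a' t b = (a' b) t` (the letters COMMUTE past `b`) through vertices `a' b q ∉ K`, so `a b ⇝ a∞ b`, and then `a∞` (deep) protects
  `a∞ b ⇝ a∞ b∞`; if `a` is deep, first `b ⇝ b∞` then `a ⇝ a∞`.  Every far vertex reaches the hub `a∞ b∞` off `K`; §1 concludes.
In print: a direct product of two infinite finitely generated groups has one end, and the number of ends is an invariant of finite-index
overgroups (Stallings' theory of ends; Freudenthal–Hopf); the form typed here (commuting pair, co-bounded product, inside an arbitrary `Cay(Γ; S)`)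
is the lane's own elementary packaging for branch-type groups (Muchnik–Pak's product lemma gives exactly these hypotheses for Grigorchuk groups).
[cite: BenjaminiSchramm1996, Def. 1 (p. 75: ends of a graph) and Question 3 (p. 79)] [cite: LyonsPeres2016, §7.6 (ends; Conj. 7.27)]
[cite: MuchnikPak2001, Lemma 2 and Cor. 1 (a product of two infinite finitely generated commuting subgroups of finite index)]
-/

noncomputable section

namespace Summit.CriticalPhenomena.PercolationContinuityZ3.Theorems.Transplant

open SimpleGraph
open scoped Classical

namespace OneEnd

/-! ## §1 The far-connectedness criterion: exactly one end -/

section Criterion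

variable {V : Type} (G : SimpleGraph V)

/-- Two vertices joined by a walk avoiding the finite set `K` lie in the same component of `G ∖ K`. [cite: BenjaminiSchramm1996, Def. 1 (p. 75)] -/
theorem componentComplMk_eq_of_walk {K : Finset V} :
    ∀ {u v : V} (p : G.Walk u v) (_ : ∀ w ∈ p.support, w ∉ K) (hu : u ∉ K) (hv : v ∉ K), G.componentComplMk hu = G.componentComplMk hv
  | _, _, .nil, _, _, _ => rfl
  | _, _, .cons a p, hp, hu, hv => by
      have hw : _ ∉ K := hp _ (List.mem_cons_of_mem _ p.start_mem_support)
      rw [G.componentComplMk_eq_of_adj hu hw a]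
      exact componentComplMk_eq_of_walk p (fun w hw' => hp w (List.mem_cons_of_mem _ hw')) hw hv

/-- **ONE-END CRITERION**: a locally finite, preconnected, infinite graph such that for every finite `K` there is a finite `L` outside which any two
vertices are joined by a walk avoiding `K` has EXACTLY ONE END (`∃! e, e ∈ G.end` — the binder of «StatementTransitiveGraphConjectures»
`BenjaminiSchramm1996_question3` / `LyonsPeres2016_conj_7_27`).  Existence: Mathlib `nonempty_ends_of_infinite`; uniqueness: the components an end
selects are infinite (`end_componentCompl_infinite`), so each meets the complement of `L`, and two such vertices lie in one component of `G ∖ K`.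
[cite: BenjaminiSchramm1996, Def. 1 (p. 75)] [cite: LyonsPeres2016, §7.6] -/
theorem end_existsUnique_of_farConnected [G.LocallyFinite] [Fact G.Preconnected] [Infinite V]
    (h : ∀ K : Finset V, ∃ L : Finset V, ∀ u v : V, u ∉ L → v ∉ L → ∃ p : G.Walk u v, ∀ w ∈ p.support, w ∉ K) :
    ∃! e, e ∈ G.end := by
  obtain ⟨e, he⟩ := nonempty_ends_of_infinite G
  refine ⟨e, he, fun e' he' => ?_⟩
  funext K
  obtain ⟨L, hL⟩ := h K.unop
  have h1 := end_componentCompl_infinite G ⟨e', he'⟩ K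
  have h2 := end_componentCompl_infinite G ⟨e, he⟩ K
  obtain ⟨u, hu, huL⟩ := h1.exists_notMem_finset L
  obtain ⟨v, hv, hvL⟩ := h2.exists_notMem_finset L
  obtain ⟨huK, hu'⟩ := hu
  obtain ⟨hvK, hv'⟩ := hv
  obtain ⟨p, hp⟩ := hL u v huL hvL
  exact hu'.symm.trans ((componentComplMk_eq_of_walk G p hp huK hvK).trans hv')

end Criterion

/-! ## §2 Right Cayley graphs: translated walks, walks inside a coset of a finitely generated subgroup, the commuting-pair theorem -/

variable {Γ : Type} [Group Γ] (S : Finset Γ)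

/-- **Translated walks**: for every `t` there is a finite pattern `P ∋ 1, t` such that from EVERY vertex `g` of `Cay(Γ; S)` a walk `g ⇝ g t` runs through
vertices `g q`, `q ∈ P` (the left translate by `g` of one fixed walk `1 ⇝ t`; left multiplication is a graph automorphism).
[cite: BenjaminiSchramm1996, §2 (Cayley graphs)] -/
theorem exists_walk_translate (hS : Subgroup.closure (S : Set Γ) = ⊤) (t : Γ) :
    ∃ P : Finset Γ, (1 : Γ) ∈ P ∧ t ∈ P ∧
      ∀ g : Γ, ∃ p : (mulCayley (S : Set Γ)).Walk g (g * t), ∀ w ∈ p.support, ∃ q ∈ P, w = g * q := by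
  obtain ⟨w₀⟩ := (CayleyScaled.connected_mulCayley_of_closure S hS).preconnected 1 t
  refine ⟨w₀.support.toFinset, List.mem_toFinset.2 w₀.start_mem_support, List.mem_toFinset.2 w₀.end_mem_support, fun g => ?_⟩
  let φ : mulCayley (S : Set Γ) →g mulCayley (S : Set Γ) := ⟨fun x => g * x, fun h => mulCayley_adj_mul_iff_right.2 h⟩
  refine ⟨(w₀.map φ).copy (mul_one g) rfl, fun w hw => ?_⟩
  rw [Walk.support_copy, Walk.support_map, List.mem_map] at hw
  obtain ⟨q, hq, rfl⟩ := hw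
  exact ⟨q, List.mem_toFinset.2 hq, rfl⟩

/-- **Walks inside a right coset `c·H` of a finitely generated subgroup `H = ⟨T⟩`**: if the letters `t ∈ T^{±}` are realised from every vertex by
walks through `g q` (`q ∈ P ∋ 1`) and NO vertex `c h q` (`h ∈ H`, `q ∈ P`) lies in `K`, then `c h ⇝ c h x` avoiding `K` for all `h, x ∈ H`.
[cite: LyonsPeres2016, §7.6] -/
theorem exists_walk_closure {K P T : Finset Γ} (h1 : (1 : Γ) ∈ P)
    (hstep : ∀ t : Γ, (t ∈ T ∨ t⁻¹ ∈ T) → ∀ g : Γ, ∃ p : (mulCayley (S : Set Γ)).Walk g (g * t), ∀ w ∈ p.support, ∃ q ∈ P, w = g * q)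
    (c : Γ) (hgood : ∀ h ∈ Subgroup.closure (T : Set Γ), ∀ q ∈ P, c * h * q ∉ K)
    {x : Γ} (hx : x ∈ Subgroup.closure (T : Set Γ)) :
    ∀ h ∈ Subgroup.closure (T : Set Γ), ∃ p : (mulCayley (S : Set Γ)).Walk (c * h) (c * (h * x)), ∀ w ∈ p.support, w ∉ K := by
  induction hx using Subgroup.closure_induction_right with
  | one =>
    intro h hh
    refine ⟨(Walk.nil : (mulCayley (S : Set Γ)).Walk (c * h) (c * h)).copy rfl (by rw [mul_one]), fun w hw => ?_⟩
    rw [Walk.support_copy, Walk.support_nil, List.mem_singleton] at hw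
    subst hw
    simpa only [mul_one] using hgood h hh 1 h1
  | mul_right x hx y hy ih =>
    intro h hh
    obtain ⟨p, hp⟩ := ih h hh
    obtain ⟨q, hq⟩ := hstep y (Or.inl (Finset.mem_coe.1 hy)) (c * (h * x))
    refine ⟨(p.append q).copy rfl (by simp only [mul_assoc]), fun w hw => ?_⟩
    rw [Walk.support_copy, Walk.mem_support_append_iff] at hw
    rcases hw with hw | hw
    · exact hp w hw
    · obtain ⟨r, hr, rfl⟩ := hq w hw
      simpa only [mul_assoc] using hgood (h * x) (Subgroup.mul_mem _ hh hx) r hr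
  | mul_inv_cancel x hx y hy ih =>
    intro h hh
    obtain ⟨p, hp⟩ := ih h hh
    obtain ⟨q, hq⟩ := hstep y⁻¹ (Or.inr (by rw [inv_inv]; exact Finset.mem_coe.1 hy)) (c * (h * x))
    refine ⟨(p.append q).copy rfl (by simp only [mul_assoc]), fun w hw => ?_⟩
    rw [Walk.support_copy, Walk.mem_support_append_iff] at hw
    rcases hw with hw | hw
    · exact hp w hw
    · obtain ⟨r, hr, rfl⟩ := hq w hw
      simpa only [mul_assoc] using hgood (h * x) (Subgroup.mul_mem _ hh hx) r hr

/-- **THE COMMUTING-PAIR THEOREM.**  Let `Γ = ⟨S⟩` with `S` finite, and let `H₁, H₂ ≤ Γ` be finitely generated INFINITE subgroups, commuting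
elementwise and meeting trivially, such that `H₁·H₂` is CO-BOUNDED: every `g ∈ Γ` has `g·f ∈ H₁·H₂` for some `f` in a fixed finite set `F`.  Then the
Cayley graph `Cay(Γ; S)` has EXACTLY ONE END: `∃! e, e ∈ (mulCayley ↑S).end`.  (In print: products of infinite groups are one-ended and ends do not see
finite index — Stallings / Freudenthal–Hopf; the present elementary form is the lane's.)
[cite: LyonsPeres2016, §7.6 (ends of graphs and groups)] [cite: MuchnikPak2001, Lemma 2 and Cor. 1] [cite: BenjaminiSchramm1996, Def. 1 (p. 75)] -/
theorem end_existsUnique_of_commuting_subgroups (hS : Subgroup.closure (S : Set Γ) = ⊤) (H₁ H₂ : Subgroup Γ)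
    (hfg₁ : H₁.FG) (hfg₂ : H₂.FG) (hinf₁ : (H₁ : Set Γ).Infinite) (hinf₂ : (H₂ : Set Γ).Infinite)
    (hc : ∀ a ∈ H₁, ∀ b ∈ H₂, Commute a b) (hd : ∀ x, x ∈ H₁ → x ∈ H₂ → x = 1)
    (hF : ∃ F : Finset Γ, ∀ g : Γ, ∃ f ∈ F, ∃ a ∈ H₁, ∃ b ∈ H₂, g * f = a * b) :
    ∃! e, e ∈ (mulCayley (S : Set Γ)).end := by
  haveI : Fact (mulCayley (S : Set Γ)).Preconnected := ⟨(CayleyScaled.connected_mulCayley_of_closure S hS).preconnected⟩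
  haveI : Infinite Γ := Set.infinite_univ_iff.1 (hinf₁.mono (Set.subset_univ _))
  obtain ⟨T₁, hT₁⟩ := hfg₁
  obtain ⟨T₂, hT₂⟩ := hfg₂
  obtain ⟨F, hF⟩ := hF
  -- unique factorisation in `H₁·H₂`
  have huniq : ∀ a ∈ H₁, ∀ b ∈ H₂, ∀ a' ∈ H₁, ∀ b' ∈ H₂, a * b = a' * b' → a = a' ∧ b = b' := by
    intro a ha b hb a' ha' b' hb' e
    have h1 : a'⁻¹ * a = b' * b⁻¹ := by
      rw [inv_mul_eq_iff_eq_mul, ← mul_assoc, eq_mul_inv_iff_mul_eq, e]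
    have hx : a'⁻¹ * a = 1 := hd _ (H₁.mul_mem (H₁.inv_mem ha') ha) (by rw [h1]; exact H₂.mul_mem hb' (H₂.inv_mem hb))
    have ha_eq : a = a' := by rwa [inv_mul_eq_one, eq_comm] at hx
    refine ⟨ha_eq, ?_⟩
    rw [ha_eq] at e
    exact mul_left_cancel e
  -- the fixed translated walks and the pattern set `P`
  choose Pt hPt1 hPtt hPt using exists_walk_translate S hS
  set D : Finset Γ := (T₁ ∪ T₁.image (·⁻¹)) ∪ (T₂ ∪ T₂.image (·⁻¹)) ∪ F with hD
  set P : Finset Γ := D.biUnion Pt ∪ {1} with hP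
  have h1P : (1 : Γ) ∈ P := Finset.mem_union_right _ (Finset.mem_singleton_self 1)
  have hstep : ∀ t ∈ D, ∀ g : Γ, ∃ p : (mulCayley (S : Set Γ)).Walk g (g * t), ∀ w ∈ p.support, ∃ q ∈ P, w = g * q := by
    intro t ht g
    obtain ⟨p, hp⟩ := hPt t g
    refine ⟨p, fun w hw => ?_⟩
    obtain ⟨q, hq, rfl⟩ := hp w hw
    exact ⟨q, Finset.mem_union_left _ (Finset.mem_biUnion.2 ⟨t, ht, hq⟩), rfl⟩
  have hFP : ∀ f ∈ F, f ∈ P := fun f hf =>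
    Finset.mem_union_left _ (Finset.mem_biUnion.2 ⟨f, by rw [hD]; exact Finset.mem_union_right _ hf, hPtt f⟩)
  have hstep₁ : ∀ t : Γ, (t ∈ T₁ ∨ t⁻¹ ∈ T₁) → ∀ g : Γ, ∃ p : (mulCayley (S : Set Γ)).Walk g (g * t), ∀ w ∈ p.support, ∃ q ∈ P, w = g * q := by
    intro t ht
    refine hstep t ?_
    rw [hD]
    rcases ht with ht | ht
    · exact Finset.mem_union_left _ (Finset.mem_union_left _ (Finset.mem_union_left _ ht))
    · exact Finset.mem_union_left _ (Finset.mem_union_left _ (Finset.mem_union_right _ (Finset.mem_image.2 ⟨t⁻¹, ht, inv_inv t⟩)))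
  have hstep₂ : ∀ t : Γ, (t ∈ T₂ ∨ t⁻¹ ∈ T₂) → ∀ g : Γ, ∃ p : (mulCayley (S : Set Γ)).Walk g (g * t), ∀ w ∈ p.support, ∃ q ∈ P, w = g * q := by
    intro t ht
    refine hstep t ?_
    rw [hD]
    rcases ht with ht | ht
    · exact Finset.mem_union_left _ (Finset.mem_union_right _ (Finset.mem_union_left _ ht))
    · exact Finset.mem_union_left _ (Finset.mem_union_right _ (Finset.mem_union_right _ (Finset.mem_image.2 ⟨t⁻¹, ht, inv_inv t⟩)))
  -- the two factor projections (junk `1` off `H₁·H₂`)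
  let π₁ : Γ → Γ := fun g => if h : ∃ a ∈ H₁, ∃ b ∈ H₂, g = a * b then h.choose else 1
  let π₂ : Γ → Γ := fun g => if h : ∃ a ∈ H₁, ∃ b ∈ H₂, g = a * b then h.choose_spec.2.choose else 1
  have hπ : ∀ a ∈ H₁, ∀ b ∈ H₂, π₁ (a * b) = a ∧ π₂ (a * b) = b := by
    intro a ha b hb
    have h : ∃ a' ∈ H₁, ∃ b' ∈ H₂, a * b = a' * b' := ⟨a, ha, b, hb, rfl⟩
    have e1 : π₁ (a * b) = h.choose := dif_pos h
    have e2 : π₂ (a * b) = h.choose_spec.2.choose := dif_pos h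
    obtain ⟨ha', b', hb', e⟩ := h.choose_spec
    have hb'' := h.choose_spec.2.choose_spec
    obtain ⟨e₁, e₂⟩ := huniq a ha b hb h.choose ha' h.choose_spec.2.choose hb''.1 hb''.2
    exact ⟨by rw [e1, ← e₁], by rw [e2, ← e₂]⟩
  -- given `K`: the non-deep candidates, deep elements, the small products, `L`
  refine end_existsUnique_of_farConnected _ fun K => ?_
  set KP : Finset Γ := (K ×ˢ P).image fun x => x.1 * x.2⁻¹ with hKP
  set N₁ : Finset Γ := KP.image π₁ with hN₁
  set N₂ : Finset Γ := KP.image π₂ with hN₂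
  have deep₁ : ∀ a ∈ H₁, a ∉ N₁ → ∀ b ∈ H₂, ∀ q ∈ P, a * b * q ∉ K := by
    intro a ha hn b hb q hq hK
    refine hn (Finset.mem_image.2 ⟨a * b, Finset.mem_image.2 ⟨(a * b * q, q), Finset.mem_product.2 ⟨hK, hq⟩, ?_⟩, (hπ a ha b hb).1⟩)
    simp only [mul_inv_cancel_right]
  have deep₂ : ∀ b ∈ H₂, b ∉ N₂ → ∀ a ∈ H₁, ∀ q ∈ P, a * b * q ∉ K := by
    intro b hb hn a ha q hq hK
    refine hn (Finset.mem_image.2 ⟨a * b, Finset.mem_image.2 ⟨(a * b * q, q), Finset.mem_product.2 ⟨hK, hq⟩, ?_⟩, (hπ a ha b hb).2⟩)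
    simp only [mul_inv_cancel_right]
  -- deep elements exist because `H₁`, `H₂` are infinite
  obtain ⟨a₀, ha₀, ha₀n⟩ : ∃ a₀ ∈ H₁, a₀ ∉ N₁ := by
    by_contra h
    push Not at h
    exact hinf₁ (N₁.finite_toSet.subset fun a ha => h a ha)
  obtain ⟨b₀, hb₀, hb₀n⟩ : ∃ b₀ ∈ H₂, b₀ ∉ N₂ := by
    by_contra h
    push Not at h
    exact hinf₂ (N₂.finite_toSet.subset fun b hb => h b hb)
  set SM : Finset Γ := (N₁ ×ˢ N₂).image fun x => x.1 * x.2 with hSM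
  refine ⟨((K ∪ SM) ×ˢ P).image fun x => x.1 * x.2⁻¹, ?_⟩
  -- the two coordinate moves
  have moveA : ∀ b ∈ H₂, (∀ a ∈ H₁, ∀ q ∈ P, a * b * q ∉ K) → ∀ a ∈ H₁, ∀ a' ∈ H₁,
      ∃ p : (mulCayley (S : Set Γ)).Walk (a * b) (a' * b), ∀ w ∈ p.support, w ∉ K := by
    intro b hb hgood a ha a' ha'
    have hgood' : ∀ h ∈ Subgroup.closure (T₁ : Set Γ), ∀ q ∈ P, b * h * q ∉ K := by
      intro h hh q hq
      rw [hT₁] at hh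
      rw [← (hc h hh b hb).eq]
      exact hgood h hh q hq
    have hx : a⁻¹ * a' ∈ Subgroup.closure (T₁ : Set Γ) := by rw [hT₁]; exact H₁.mul_mem (H₁.inv_mem ha) ha'
    obtain ⟨p, hp⟩ := exists_walk_closure S h1P hstep₁ b hgood' hx a (by rw [hT₁]; exact ha)
    refine ⟨p.copy (hc a ha b hb).eq.symm (by rw [mul_inv_cancel_left]; exact (hc a' ha' b hb).eq.symm), fun w hw => ?_⟩
    rw [Walk.support_copy] at hw
    exact hp w hw
  have moveB : ∀ a ∈ H₁, (∀ b ∈ H₂, ∀ q ∈ P, a * b * q ∉ K) → ∀ b ∈ H₂, ∀ b' ∈ H₂,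
      ∃ p : (mulCayley (S : Set Γ)).Walk (a * b) (a * b'), ∀ w ∈ p.support, w ∉ K := by
    intro a ha hgood b hb b' hb'
    have hgood' : ∀ h ∈ Subgroup.closure (T₂ : Set Γ), ∀ q ∈ P, a * h * q ∉ K := by
      intro h hh q hq
      rw [hT₂] at hh
      exact hgood h hh q hq
    have hx : b⁻¹ * b' ∈ Subgroup.closure (T₂ : Set Γ) := by rw [hT₂]; exact H₂.mul_mem (H₂.inv_mem hb) hb'
    obtain ⟨p, hp⟩ := exists_walk_closure S h1P hstep₂ a hgood' hx b (by rw [hT₂]; exact hb)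
    refine ⟨p.copy rfl (by rw [mul_inv_cancel_left]), fun w hw => ?_⟩
    rw [Walk.support_copy] at hw
    exact hp w hw
  -- every vertex off `L` reaches the hub `a₀ b₀` avoiding `K`
  have hub : ∀ u : Γ, u ∉ ((K ∪ SM) ×ˢ P).image (fun x => x.1 * x.2⁻¹) →
      ∃ p : (mulCayley (S : Set Γ)).Walk u (a₀ * b₀), ∀ w ∈ p.support, w ∉ K := by
    intro u hu
    obtain ⟨f, hf, a, ha, b, hb, hfab⟩ := hF u
    -- step 0: `u ⇝ u f = a b`
    obtain ⟨p₀, hp₀⟩ := hstep f (by rw [hD]; exact Finset.mem_union_right _ hf) u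
    have hp₀K : ∀ w ∈ p₀.support, w ∉ K := by
      intro w hw hK
      obtain ⟨q, hq, rfl⟩ := hp₀ w hw
      exact hu (Finset.mem_image.2 ⟨(u * q, q), Finset.mem_product.2 ⟨Finset.mem_union_left _ hK, hq⟩, by simp only [mul_inv_cancel_right]⟩)
    -- `a b` is not small: one factor is deep
    have hdeep : a ∉ N₁ ∨ b ∉ N₂ := by
      by_contra h
      push Not at h
      refine hu (Finset.mem_image.2 ⟨(a * b, f), Finset.mem_product.2 ⟨Finset.mem_union_right _ ?_, hFP f hf⟩, ?_⟩)
      · exact Finset.mem_image.2 ⟨(a, b), Finset.mem_product.2 h, rfl⟩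
      · simp only [← hfab, mul_inv_cancel_right]
    rcases hdeep with hda | hdb
    · -- `a` deep: `a b ⇝ a b₀ ⇝ a₀ b₀`
      obtain ⟨p₁, hp₁⟩ := moveB a ha (deep₁ a ha hda) b hb b₀ hb₀
      obtain ⟨p₂, hp₂⟩ := moveA b₀ hb₀ (fun a' ha' => deep₂ b₀ hb₀ hb₀n a' ha') a ha a₀ ha₀
      refine ⟨(p₀.copy rfl hfab).append (p₁.append p₂), fun w hw => ?_⟩
      rw [Walk.mem_support_append_iff, Walk.support_copy, Walk.mem_support_append_iff] at hw
      rcases hw with hw | hw | hw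
      · exact hp₀K w hw
      · exact hp₁ w hw
      · exact hp₂ w hw
    · -- `b` deep: `a b ⇝ a₀ b ⇝ a₀ b₀`
      obtain ⟨p₁, hp₁⟩ := moveA b hb (fun a' ha' => deep₂ b hb hdb a' ha') a ha a₀ ha₀
      obtain ⟨p₂, hp₂⟩ := moveB a₀ ha₀ (deep₁ a₀ ha₀ ha₀n) b hb b₀ hb₀
      refine ⟨(p₀.copy rfl hfab).append (p₁.append p₂), fun w hw => ?_⟩
      rw [Walk.mem_support_append_iff, Walk.support_copy, Walk.mem_support_append_iff] at hw
      rcases hw with hw | hw | hw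
      · exact hp₀K w hw
      · exact hp₁ w hw
      · exact hp₂ w hw
  intro u v hu hv
  obtain ⟨p, hp⟩ := hub u hu
  obtain ⟨q, hq⟩ := hub v hv
  refine ⟨p.append q.reverse, fun w hw => ?_⟩
  rw [Walk.mem_support_append_iff, Walk.support_reverse, List.mem_reverse] at hw
  exact hw.elim (hp w) (hq w)

end OneEnd

end Summit.CriticalPhenomena.PercolationContinuityZ3.Theorems.Transplant

end
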